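import Mathlib
import HarnessLib
import Summits.NavierStokesRegularity.NavierStokesRegularity.Theorems.PoloidalWindowDoorPoloidalWindowRigidityTimeShearLiminfDecay
import Summits.NavierStokesRegularity.NavierStokesRegularity.Theorems.PoloidalWindowDoorPoloidalWindowRigidityTimeShearTest

/-!
# Route `PoloidalWindowDoor`, crux `PoloidalWindowRigidity` (K2, stmt-NavierStokesRegularity-19708), line `lrc-jet`,
# stub `stub_tvLiminf` — (TV), branch (B): the tested momentum equation ⇒ the shifted source `f₂ − κv₂` is
# spatially constant

Cell ns-regularity-ideate, seat ns-poloidal-K2-p2 gen 3 (stub-worker under the K2 lead ns-poloidal-K2-p1 g4; file landed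
`--supports stmt-NavierStokesRegularity-19708` as a helper toward the registered stub `stub_tvLiminf`).
Continuation of `…TimeShearLiminfDecay` (`variance_small_liminf`) with ns-poloidal-K2-p3 g4's tested momentum equation
`…TimeShearTest.abs_integral_vresTV_mul_le` for the shifted vertical residual `g̃ = f₂ − κv₂`
(`f = ∂ₜv + (v·∇)v − Δv`, `κ = μ′/(1−μ)`):

* `continuous_vresTV`, `integral_vresTV_mul_bumps_eq_zero_liminf` — `∫ g̃(t, z e₂)(ρ₁ − ρ₂)(z) dz = 0` for two
  normalised bumps of the height;
* `vresTV_eq_liminf` — `g̃(t,·)` is constant in the height (continuity + shrinking bumps);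
* `vsub_const_liminf` — hence SPATIALLY CONSTANT (height-only by K2-p3's
  `…TimeShearVariance.residual_vert_sub_eq_of_height_eq_TV`).

The sequel `…TimeShearLiminf` runs the sequential decaying-slope Liouville lemma on `ψ = (1−μ)v₂` and closes
`stub_tvLiminf`.

WHAT THIS IS NOT: not a claim about Navier–Stokes regularity, not (TV) and not LRC″ — bricks of branch (B) of one located
stratum (bears_on LADDER-NS N0, rung N0-LocalTubeDoorPoloidal, crux K2 = stmt-19708).
-/

noncomputable section

-- the summit and its single sub-problem share the name (CONVENTIONS §1), as in every Theorems file
set_option linter.dupNamespace false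

namespace Summit.NavierStokesRegularity.NavierStokesRegularity.Theorems.PoloidalWindowDoorPoloidalWindowRigidityTimeShearLiminfSource

open MeasureTheory Set Function Filter Topology Metric InnerProductSpace
open scoped RealInnerProductSpace InnerProductSpace Laplacian ContDiff
open Literature.Analysis Literature.Analysis.FluidPDE
open Summit.NavierStokesRegularity.NavierStokesRegularity.Theorems.PoloidalWindowDoorPoloidalWindowRigidityWindow
open Summit.NavierStokesRegularity.NavierStokesRegularity.Theorems.PoloidalWindowDoorPoloidalWindowRigidityClassRate
open Summit.NavierStokesRegularity.NavierStokesRegularity.Theorems.PoloidalWindowDoorPoloidalWindowRigidityHorizontalMean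
open Summit.NavierStokesRegularity.NavierStokesRegularity.Theorems.PoloidalWindowDoorPoloidalWindowRigidityConstantShearMeans
open Summit.NavierStokesRegularity.NavierStokesRegularity.Theorems.PoloidalWindowDoorPoloidalWindowRigidityConstantShearSlice
open Summit.NavierStokesRegularity.NavierStokesRegularity.Theorems.PoloidalWindowDoorPoloidalWindowRigidityConstantShearVariance
open Summit.NavierStokesRegularity.NavierStokesRegularity.Theorems.PoloidalWindowDoorPoloidalWindowRigidityConstantShearTest
open Summit.NavierStokesRegularity.NavierStokesRegularity.Theorems.PoloidalWindowDoorPoloidalWindowRigidityTimeShearVariance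
open Summit.NavierStokesRegularity.NavierStokesRegularity.Theorems.PoloidalWindowDoorPoloidalWindowRigidityTimeShearTest
open Summit.NavierStokesRegularity.NavierStokesRegularity.Theorems.PoloidalWindowDoorPoloidalWindowRigidityTimeShearLiminfDecay

variable {v : ℝ → EuclideanSpace ℝ (Fin 3) → EuclideanSpace ℝ (Fin 3)} {C : ℝ}

section Class

variable (hrate : HasTypeITimeDecay C v) (hcont : ContinuousOn (uncurry v) (Iio (0 : ℝ) ×ˢ univ))
  (hmild : ∀ s t : ℝ, s < t → t < 0 → ∀ x,
    v t x = UnboundedOperators.heatExtension (v s) (t - s) x - oseenDuhamel 1 s v v t x)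
  (hdiv : ∀ t < 0, VectorCalculus.IsDivFree (v t))
  (hpol : ∀ s < 0, ∀ y, ⟪curl (v s) y, EuclideanSpace.single 2 1⟫_ℝ = 0)
  {μ : ℝ → ℝ} (hμneg : ∀ s < 0, μ s < 0) (hμd : ∀ s < 0, DifferentiableAt ℝ μ s)
  (hslope : ∀ s < 0, ∀ y, ∀ b : Fin 3, b ≠ 2 →
    fderiv ℝ (v s) y (EuclideanSpace.single 2 1) b = μ s * fderiv ℝ (v s) y (EuclideanSpace.single b 1) 2)

include hrate hcont hmild hdiv hpol hμneg hμd hslope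

omit hpol hμneg hμd hslope in
/-- `z ↦ g̃(t,z)` is continuous. -/
theorem continuous_vresTV {t : ℝ} (ht : t < 0) :
    Continuous fun z => vres v t z - deriv μ t / (1 - μ t) * v t (z • EuclideanSpace.single 2 (1 : ℝ)) 2 := by
  have hA : IsTypeIAncientMild C v := isTypeIAncientMild_of_class hrate hcont hmild hdiv
  have hvc : Continuous (v t) := (hA.contDiff_slice ht).continuous
  refine (continuous_vres hrate hcont hmild hdiv ht).sub (continuous_const.mul ?_)
  exact (EuclideanSpace.proj (𝕜 := ℝ) (2 : Fin 3)).continuous.comp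
    (hvc.comp (continuous_id.smul continuous_const))

/-- **`∫ g̃(t,z) (ρ₁ − ρ₂)(z) dz = 0`** for two normalised bumps of the height, `g̃ = f₂ − κv₂` the shifted vertical
residual on (TV) (liminf branch): the tested momentum equation (`…TimeShearTest`) + `variance_small_liminf`. -/
theorem integral_vresTV_mul_bumps_eq_zero_liminf {M : ℝ} (hM : ∀ T : ℝ, ∃ τ < T, -M ≤ μ τ)
    {t : ℝ} (ht : t < 0) {z₁ z₂ : ℝ} (β₁ : ContDiffBump z₁) (β₂ : ContDiffBump z₂) :
    ∫ z, (vres v t z - deriv μ t / (1 - μ t) * v t (z • EuclideanSpace.single 2 (1 : ℝ)) 2) *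
      (β₁.normed volume z - β₂.normed volume z) = 0 := by
  have hμd' : HasDerivAt μ (deriv μ t) t := (hμd t ht).hasDerivAt
  have hμ1' : μ t ≠ 1 := by linarith [hμneg t ht]
  set g : ℝ → ℝ := fun z => vres v t z - deriv μ t / (1 - μ t) * v t (z • EuclideanSpace.single 2 (1 : ℝ)) 2 with hg
  show ∫ z, g z * (β₁.normed volume z - β₂.normed volume z) = 0
  -- a fixed bump in the plane, the class rates
  set φ : ContDiffBump (0 : EuclideanSpace ℝ (Fin 2)) := ⟨1, 2, one_pos, one_lt_two⟩ with hφ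
  obtain ⟨C₁, hC₁⟩ := exists_fderiv_rate_of_class hrate hcont hmild
  obtain ⟨C₄, hC₄⟩ := exists_timeDeriv_rate_of_class hrate hcont hmild
  -- the test function `ρ = ρ₁ − ρ₂` and the window `[a, b]`
  set ρ : ℝ → ℝ := fun z => β₁.normed volume z - β₂.normed volume z with hρdef
  set a : ℝ := min (z₁ - β₁.rOut) (z₂ - β₂.rOut) with ha
  set b : ℝ := max (z₁ + β₁.rOut) (z₂ + β₂.rOut) with hb
  have hab : a ≤ b := by
    have h1 : a ≤ z₁ - β₁.rOut := min_le_left _ _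
    have h2 : z₁ + β₁.rOut ≤ b := le_max_left _ _
    linarith [β₁.rOut_pos]
  have hρ : ContDiff ℝ 1 ρ := (β₁.contDiff_normed (n := 1)).sub (β₂.contDiff_normed (n := 1))
  have hout : ∀ z ∉ Icc a b, z ∉ Metric.ball z₁ β₁.rOut ∧ z ∉ Metric.ball z₂ β₂.rOut := by
    intro z hz
    rw [mem_Icc, not_and_or, not_le, not_le] at hz
    have h1 : a ≤ z₁ - β₁.rOut := min_le_left _ _
    have h2 : a ≤ z₂ - β₂.rOut := min_le_right _ _
    have h3 : z₁ + β₁.rOut ≤ b := le_max_left _ _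
    have h4 : z₂ + β₂.rOut ≤ b := le_max_right _ _
    constructor <;> rw [Metric.mem_ball, Real.dist_eq, abs_lt, not_and_or, not_lt, not_lt] <;>
      rcases hz with hz | hz
    · left; linarith
    · right; linarith
    · left; linarith
    · right; linarith
  have hρ0 : ∀ z ∉ Icc a b, ρ z = 0 := by
    intro z hz
    obtain ⟨h1, h2⟩ := hout z hz
    have e1 : β₁.normed volume z = 0 := by
      rw [← Function.notMem_support, β₁.support_normed_eq]; exact h1
    have e2 : β₂.normed volume z = 0 := by
      rw [← Function.notMem_support, β₂.support_normed_eq]; exact h2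
    simp [hρdef, e1, e2]
  have hρ1 : ∀ z ∉ Icc a b, deriv ρ z = 0 := by
    intro z hz
    have hopen : IsOpen (Icc a b)ᶜ := isClosed_Icc.isOpen_compl
    have hev : ρ =ᶠ[𝓝 z] fun _ => (0 : ℝ) := by
      filter_upwards [hopen.mem_nhds hz] with w hw using hρ0 w hw
    rw [hev.deriv_eq, deriv_const]
  have hρi : ∫ z, ρ z = 0 := by
    simp only [hρdef]
    rw [integral_sub β₁.integrable_normed β₂.integrable_normed, β₁.integral_normed, β₂.integral_normed, sub_self]
  -- bounds for `ρ'` and `‖ρ‖₁`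
  have hρ'c : Continuous (deriv ρ) := hρ.continuous_deriv le_rfl
  have hρ'supp : HasCompactSupport (deriv ρ) :=
    HasCompactSupport.of_support_subset_isCompact isCompact_Icc fun z hz => by
      by_contra h; exact hz (hρ1 z h)
  obtain ⟨B₁, hB₁⟩ := hρ'supp.exists_bound_of_continuous hρ'c
  have hB₁' : ∀ z, |deriv ρ z| ≤ B₁ := fun z => by rw [← Real.norm_eq_abs]; exact hB₁ z
  have hB₁0 : 0 ≤ B₁ := (norm_nonneg _).trans (hB₁ 0)
  set N : ℝ := ∫ z, |ρ z| with hN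
  have hN0 : 0 ≤ N := integral_nonneg fun z => abs_nonneg _
  set Kc : ℝ := ((C / Real.sqrt (-t) * (C / Real.sqrt (-t)) + C₁ / (-t)) + C₁ / (-t) +
    2 * (C / Real.sqrt (-t) * (C / Real.sqrt (-t))) +
    (C₄ / ((-t) * Real.sqrt (-t)) + |deriv μ t / (1 - μ t)| * (C / Real.sqrt (-t))) * (b - a)) * bumpK φ with hKc
  -- the estimate at every scale `R > 0`
  have hest : ∀ R : ℝ, 0 < R → |∫ z, g z * ρ z| ≤
      B₁ * (∫ z in Icc a b, sliceV φ R v t z) + N * (R⁻¹ * Kc) := by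
    intro R hR
    have h := abs_integral_vresTV_mul_le (φ := φ) hrate hcont hmild hdiv hpol hslope ht hμd' hμ1' hC₁ hC₄ hR hab hρ
      hρ0 hρ1 hρi hB₁'
    simpa only [hKc, hN, hg, mul_assoc] using h
  -- `|∫ g̃ ρ| ≤ ε` for every `ε > 0`
  have hsmall : ∀ ε : ℝ, 0 < ε → |∫ z, g z * ρ z| ≤ ε := by
    intro ε hε
    obtain ⟨R₀, hR₀, hvar⟩ := variance_small_liminf (φ := φ) hrate hcont hmild hdiv hpol hμneg hμd hslope hC₁ hC₄ hM
      ht a b (ε := ε / (2 * (B₁ + 1))) (by positivity)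
    set R : ℝ := max R₀ (2 * N * |Kc| / ε + 1) with hRdef
    have hR₀R : R₀ ≤ R := le_max_left _ _
    have hR : 0 < R := lt_of_lt_of_le hR₀ hR₀R
    have hR2 : 2 * N * |Kc| / ε + 1 ≤ R := le_max_right _ _
    have h1 := hest R hR
    have hV : ∫ z in Icc a b, sliceV φ R v t z ≤ ε / (2 * (B₁ + 1)) := hvar R hR₀R
    -- first term `≤ ε/2`
    have hT1 : B₁ * (∫ z in Icc a b, sliceV φ R v t z) ≤ ε / 2 := by
      calc B₁ * (∫ z in Icc a b, sliceV φ R v t z) ≤ B₁ * (ε / (2 * (B₁ + 1))) :=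
            mul_le_mul_of_nonneg_left hV hB₁0
        _ = ε / 2 * (B₁ / (B₁ + 1)) := by field_simp
        _ ≤ ε / 2 * 1 := mul_le_mul_of_nonneg_left ((div_le_one (by linarith)).2 (by linarith)) (by positivity)
        _ = ε / 2 := mul_one _
    -- second term `≤ ε/2`
    have hT2 : N * (R⁻¹ * Kc) ≤ ε / 2 := by
      have hle : N * (R⁻¹ * Kc) ≤ N * |Kc| / R := by
        rw [mul_comm R⁻¹, ← mul_assoc, ← div_eq_mul_inv]
        exact div_le_div_of_nonneg_right (mul_le_mul_of_nonneg_left (le_abs_self _) hN0) hR.le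
      refine hle.trans ?_
      rw [div_le_iff₀ hR]
      have h3 : 2 * N * |Kc| / ε ≤ R := by linarith
      have h4 := mul_le_mul_of_nonneg_left h3 (by positivity : (0:ℝ) ≤ ε / 2)
      have e : ε / 2 * (2 * N * |Kc| / ε) = N * |Kc| := by field_simp
      linarith [e]
    linarith
  -- hence `= 0`
  have h0 : |∫ z, g z * ρ z| ≤ 0 := by
    by_contra hne
    push Not at hne
    have h := hsmall (|∫ z, g z * ρ z| / 2) (by positivity)
    linarith
  exact abs_eq_zero.1 (le_antisymm h0 (abs_nonneg _))

/-- **The shifted vertical residual `g̃ = f₂ − κv₂` is height-independent** on (TV), liminf branch. -/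
theorem vresTV_eq_liminf {M : ℝ} (hM : ∀ T : ℝ, ∃ τ < T, -M ≤ μ τ) {t : ℝ} (ht : t < 0) (z₁ z₂ : ℝ) :
    vres v t z₁ - deriv μ t / (1 - μ t) * v t (z₁ • EuclideanSpace.single 2 (1 : ℝ)) 2 =
      vres v t z₂ - deriv μ t / (1 - μ t) * v t (z₂ • EuclideanSpace.single 2 (1 : ℝ)) 2 := by
  set g : ℝ → ℝ := fun z => vres v t z - deriv μ t / (1 - μ t) * v t (z • EuclideanSpace.single 2 (1 : ℝ)) 2
    with hgdef
  have hg : Continuous g := continuous_vresTV (μ := μ) hrate hcont hmild hdiv ht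
  show g z₁ = g z₂
  -- two-sided bound `|g z₁ − g z₂| ≤ 2η` for every `η > 0`
  have key : ∀ η : ℝ, 0 < η → |g z₁ - g z₂| ≤ 2 * η := by
    intro η hη
    -- a common radius on which `g` oscillates by at most `η` about both points
    have hc1 := Metric.continuous_iff.1 hg z₁ η hη
    have hc2 := Metric.continuous_iff.1 hg z₂ η hη
    obtain ⟨r₁, hr₁, h₁⟩ := hc1
    obtain ⟨r₂, hr₂, h₂⟩ := hc2
    set r : ℝ := min r₁ r₂ with hr
    have hr0 : 0 < r := lt_min hr₁ hr₂
    set β₁ : ContDiffBump z₁ := ⟨r / 2, r, by positivity, by linarith⟩ with hβ₁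
    set β₂ : ContDiffBump z₂ := ⟨r / 2, r, by positivity, by linarith⟩ with hβ₂
    have hint : ∫ z, g z * (β₁.normed volume z - β₂.normed volume z) = 0 :=
      integral_vresTV_mul_bumps_eq_zero_liminf hrate hcont hmild hdiv hpol hμneg hμd hslope hM ht β₁ β₂
    -- `∫ g ρᵢ` is within `η` of `g zᵢ`
    have happrox : ∀ {c : ℝ} (β : ContDiffBump c), β.rOut ≤ r₁ ⊓ r₂ →
        (∀ z, dist z c < β.rOut → dist (g z) (g c) < η) →
        |(∫ z, g z * β.normed volume z) - g c| ≤ η := by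
      intro c β _ hosc
      have hi : Integrable fun z => g z * β.normed volume z :=
        (hg.mul β.continuous_normed).integrable_of_hasCompactSupport β.hasCompactSupport_normed.mul_left
      have hic : Integrable fun z => g c * β.normed volume z :=
        (continuous_const.mul β.continuous_normed).integrable_of_hasCompactSupport β.hasCompactSupport_normed.mul_left
      have hconst : ∫ z, g c * β.normed volume z = g c := by
        rw [integral_const_mul, β.integral_normed, mul_one]
      have hsub : ∫ z, (g z - g c) * β.normed volume z =
          (∫ z, g z * β.normed volume z) - g c := by
        rw [show (fun z => (g z - g c) * β.normed volume z) =
          fun z => g z * β.normed volume z - g c * β.normed volume z from funext fun z => by ring,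
          integral_sub hi hic, hconst]
      rw [← hsub]
      have hbd : ∀ z, |(g z - g c) * β.normed volume z| ≤ η * β.normed volume z := by
        intro z
        rw [abs_mul, abs_of_nonneg (β.nonneg_normed z)]
        by_cases hz : z ∈ Metric.ball c β.rOut
        · exact mul_le_mul_of_nonneg_right (le_of_lt (by
            have := hosc z (Metric.mem_ball.1 hz); rwa [Real.dist_eq] at this)) (β.nonneg_normed z)
        · have : β.normed volume z = 0 := by rw [← Function.notMem_support, β.support_normed_eq]; exact hz
          simp [this]
      calc |∫ z, (g z - g c) * β.normed volume z|
          ≤ ∫ z, |(g z - g c) * β.normed volume z| := abs_integral_le_integral_abs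
        _ ≤ ∫ z, η * β.normed volume z :=
            integral_mono_of_nonneg (Eventually.of_forall fun z => abs_nonneg _) (β.integrable_normed.const_mul η)
              (Eventually.of_forall hbd)
        _ = η := by rw [integral_const_mul, β.integral_normed, mul_one]
    have hle : r ≤ r₁ ⊓ r₂ := le_rfl
    have ha1 := happrox β₁ hle fun z hz => h₁ z (lt_of_lt_of_le hz (min_le_left _ _))
    have ha2 := happrox β₂ hle fun z hz => h₂ z (lt_of_lt_of_le hz (min_le_right _ _))
    -- `∫ g (ρ₁ − ρ₂) = 0`
    have hsplit : ∫ z, g z * (β₁.normed volume z - β₂.normed volume z) =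
        (∫ z, g z * β₁.normed volume z) - ∫ z, g z * β₂.normed volume z := by
      simp only [mul_sub]
      exact integral_sub ((hg.mul β₁.continuous_normed).integrable_of_hasCompactSupport β₁.hasCompactSupport_normed.mul_left)
        ((hg.mul β₂.continuous_normed).integrable_of_hasCompactSupport β₂.hasCompactSupport_normed.mul_left)
    rw [hsplit] at hint
    have e : g z₁ - g z₂ =
        -((∫ z, g z * β₁.normed volume z) - g z₁) +
          ((∫ z, g z * β₂.normed volume z) - g z₂) := by linarith
    rw [e]
    calc _ ≤ |-((∫ z, g z * β₁.normed volume z) - g z₁)| +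
          |(∫ z, g z * β₂.normed volume z) - g z₂| := abs_add_le _ _
      _ ≤ η + η := by rw [abs_neg]; exact add_le_add ha1 ha2
      _ = 2 * η := by ring
  have h0 : |g z₁ - g z₂| ≤ 0 := by
    by_contra hne
    push Not at hne
    have h := key (|g z₁ - g z₂| / 4) (by positivity)
    linarith
  exact sub_eq_zero.1 (abs_eq_zero.1 (le_antisymm h0 (abs_nonneg _)))


/-- **`f₂ − κv₂` is SPATIALLY CONSTANT on every slice** (liminf branch): height-only by
`…TimeShearVariance.residual_vert_sub_eq_of_height_eq_TV`, height-independent by `vresTV_eq_liminf`. -/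
theorem vsub_const_liminf {M : ℝ} (hM : ∀ T : ℝ, ∃ τ < T, -M ≤ μ τ) {t : ℝ} (ht : t < 0)
    (x : EuclideanSpace ℝ (Fin 3)) :
    (timeDerivWithin (Iio 0) v t x + convect (v t) (v t) x - Δ (v t) x) 2 - deriv μ t / (1 - μ t) * v t x 2 =
      (timeDerivWithin (Iio 0) v t 0 + convect (v t) (v t) 0 - Δ (v t) 0) 2 - deriv μ t / (1 - μ t) * v t 0 2 := by
  have hμd' : HasDerivAt μ (deriv μ t) t := (hμd t ht).hasDerivAt
  have hμ1' : μ t ≠ 1 := by linarith [hμneg t ht]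
  have h1 := residual_vert_sub_eq_of_height_eq_TV hrate hcont hmild hdiv hpol hslope ht hμd' hμ1'
    (x := x) (x' := (x 2) • EuclideanSpace.single 2 (1 : ℝ)) (by simp)
  have h2 := residual_vert_sub_eq_of_height_eq_TV hrate hcont hmild hdiv hpol hslope ht hμd' hμ1'
    (x := (0 : EuclideanSpace ℝ (Fin 3))) (x' := (0 : ℝ) • EuclideanSpace.single 2 (1 : ℝ)) (by simp)
  have h3 := vresTV_eq_liminf hrate hcont hmild hdiv hpol hμneg hμd hslope hM ht (x 2) 0
  simp only [vres] at h3
  rw [h1, h3, ← h2]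

end Class

end Summit.NavierStokesRegularity.NavierStokesRegularity.Theorems.PoloidalWindowDoorPoloidalWindowRigidityTimeShearLiminfSource

end
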